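import Summits.Ventures.Crystal3D.Theorems.StickyWulffConstantTextureLiminfTexShadowLevelReachCut
import Summits.Ventures.Crystal3D.Theorems.StickyWulffConstantTextureLiminfTexShadowLevelReachReadingRigidity
import Summits.Ventures.Crystal3D.Theorems.StickyWulffConstantTextureLiminfTexShadowLevelReachMirrorLaunch
import HarnessLib

/-!
# MIRROR LAUNCHES have NO relaunch term: the family census of the (β) level lines, losses located at the inverted readings
# (lane T, crux `TextureLiminfV5`, stmt-Ventures-23912, registered stub `stub_terraceCensus`; (β) terrace census, LevelReach — relaunch term settled)

HONEST FRAMING. Venture `Summits/Ventures/Crystal3D` (cell `crystal3d-full`), route `route-Ventures-StickyWulffConstant`, helper `--supports` the law-v5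
crux `TextureLiminfV5` (stmt-Ventures-23912), lane T, mechanism (β) (HOME/wall-p1-g19/BETA-LEDGER-RESUME-g19.md §4(2), §6 T3; HANDOFF «wall-p1 gen 21 FINAL»
RESUME (3) «LevelReachRelaunch»).  Census-free, certificate-free; `KissingGap δ`, `KissingClassification δ` BY NAME as in lane F's census; F-C1 not moved.

THE POINT.  The level-`k` lines of the (β) ledger are launched at the MIRROR BALLS `r + A′w` of located twin readings `r` of `(A, n)` (`A′ = A − 2⟪A·, n⟫ n`
the lamella frame, `w` a near slot, `⟪A w, n⟫ < 0`; …TexShadowLevelReachMirrorLaunch p740126).  Feeding them to the CUT census `word_family_endPairs_launch_cut`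
(…TexShadowLevelReachCut) with root frame `F [] = A′`, root slot `u [] = w` and cut letter `μ₀ = A′⁻¹ n`:
* the STRAIGHT relaunch is void under the predecessor property of the invariant (`hPpred`; `pred_mirrorLaunch_not_mem`: `r − A′w ∉ X`);
* the CROSS relaunch is void: the popping letter reads `(M_μ ≫ A′, A′μ)` at the reading `r` of `(A, n)`, so `μ = A′⁻¹ n = μ₀` (`relaunch_letter_eq`,
  …TexShadowLevelReachReadingRigidity), which the cut excludes;
hence **`mirrorLaunch_endPairs_cut`**: for a finite set `Rd` of twin readings of `(A, n)` whose mirror balls move straight,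
`#{r ∈ Rd : second ball inside the window} ≤ #T + #INV + 220·#rim_top + 220·#rim_bot`, `T` = typed END PAIRS with lane F's four exported properties
(dischargeable by the certificate BY NAME), `INV` = the LOCATED INVERTED READINGS: balls `b` in the window with `IsTwinReading X A′ n b` (lamella frame below,
reading frame above — a stacked family plane, i.e. a cancelling pair of the column word (I5)), `P (b, [])`, `b − A′w ∈ X`.  NO relaunch term.
WHAT THIS IS NOT: the supply count `#Rd` (slab pinning), the bound on `#INV` (the assembly's T3), the multi-root pooling, any certificate; F-C1 not moved.
-/

noncomputable section

namespace Summit.Ventures.Crystal3D.Cruxes.TextureLiminf.TexShadow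

open Finset Summit.Ventures.Crystal3D Summit.Ventures.Crystal3D.Theorems
open scoped InnerProductSpace

variable {X : Finset (EuclideanSpace ℝ (Fin 3))}
  {F : List (EuclideanSpace ℝ (Fin 3)) → (EuclideanSpace ℝ (Fin 3) ≃ₗᵢ[ℝ] EuclideanSpace ℝ (Fin 3))}
  {u : List (EuclideanSpace ℝ (Fin 3)) → EuclideanSpace ℝ (Fin 3)}
  {WF : List (EuclideanSpace ℝ (Fin 3)) → Prop}
  {next : List (EuclideanSpace ℝ (Fin 3)) → EuclideanSpace ℝ (Fin 3) → List (EuclideanSpace ℝ (Fin 3))}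
  {P' P₂ : Finset (EuclideanSpace ℝ (Fin 3))} {R₀ h ρ : ℝ}

/-- The popping letter of a one-letter class: `next [μ] m = []` forces `m = F [] μ` (for a unit letter). -/
theorem normal_eq_of_next_singleton_nil (hFc : ∀ μ κ, F (μ :: κ) = ((ℝ ∙ μ)ᗮ.reflection).trans (F κ))
    (hnext_push : ∀ κ (m : EuclideanSpace ℝ (Fin 3)), (∀ μ κ', κ = μ :: κ' → (F κ).symm m ≠ -μ) →
      next κ m = (F κ).symm m :: κ)
    {μ m : EuclideanSpace ℝ (Fin 3)} (hμ : ‖μ‖ = 1) (hnil : next [μ] m = []) : m = F [] μ := by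
  have hpop : (F [μ]).symm m = -μ := by
    by_contra hne
    have := hnext_push [μ] m (fun μ' κ' he => by obtain ⟨rfl, rfl⟩ := List.cons_eq_cons.1 he; exact hne)
    rw [hnil] at this; exact absurd this.symm (List.cons_ne_nil _ _)
  have : m = F [μ] (-μ) := by rw [← hpop, LinearIsometryEquiv.apply_symm_apply]
  rw [this, hFc, LinearIsometryEquiv.trans_apply, reflection_unit_apply hμ, inner_neg_left, real_inner_self_eq_norm_sq, hμ]
  congr 1; simp; module

open scoped Classical in
/-- **THE FAMILY CENSUS OF MIRROR LAUNCHES, no relaunch term.**  Word data `F, u, WF, next` as in lane F's census with ROOT FRAME the lamella frame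
(`hA' : F [] = A − 2⟪A·, n⟫ n` pointwise) and ROOT SLOT a near slot of the reading frame (`⟪A (u []), n⟫ < 0`); `Rd` a finite set of twin readings of
`(A, n)` whose mirror balls `r + F [] (u [])` move STRAIGHT (`hmov`) and start the invariant one step later (`hP0`); the invariant `P` has the
predecessor property (`hPpred`), is preserved by straight moves and by crosses off the cut (`κ ≠ [] ∨ m ≠ n`), and excludes the top plate (`hPexcl0`).
Then the readings whose second line ball lies inside the window number at most `#T + #INV + 220·(#rim_top + #rim_bot)` — see the module docstring. -/
theorem mirrorLaunch_endPairs_cut (ver : WordVersion) {δ : ℝ} (hg : KissingGap δ) (hc : KissingClassification δ)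
    (hX : ∀ p ∈ X, ∀ q ∈ X, p ≠ q → 1 ≤ dist p q)
    (hFc : ∀ μ κ, F (μ :: κ) = ((ℝ ∙ μ)ᗮ.reflection).trans (F κ))
    (hu : ∀ κ, u κ ∈ fccSlots) (huc : ∀ μ κ, u (μ :: κ) = -u κ)
    (hWF0 : WF [])
    (hWFc : ∀ μ κ, WF (μ :: κ) ↔ (WF κ ∧ ‖μ‖ = 1 ∧
      (∀ w ∈ fccSlots, ⟪w, μ⟫_ℝ = 0 ∨ ⟪w, μ⟫_ℝ = Real.sqrt (2 / 3) ∨ ⟪w, μ⟫_ℝ = -Real.sqrt (2 / 3)) ∧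
      ⟪u κ, μ⟫_ℝ = Real.sqrt (2 / 3) ∧ ∀ μ' κ', κ = μ' :: κ' → μ' ≠ -μ))
    (hnext_pop : ∀ μ κ' (m : EuclideanSpace ℝ (Fin 3)), (F (μ :: κ')).symm m = -μ → next (μ :: κ') m = κ')
    (hnext_push : ∀ κ (m : EuclideanSpace ℝ (Fin 3)), (∀ μ κ', κ = μ :: κ' → (F κ).symm m ≠ -μ) →
      next κ m = (F κ).symm m :: κ)
    -- the reading frame, its normal, the lamella frame `F []` as its mirror, the near root slot
    (A : EuclideanSpace ℝ (Fin 3) ≃ₗᵢ[ℝ] EuclideanSpace ℝ (Fin 3)) {n : EuclideanSpace ℝ (Fin 3)}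
    (hA' : ∀ x, F [] x = A x - (2 * ⟪A x, n⟫_ℝ) • n) (hwn : ⟪A (u []), n⟫_ℝ < 0)
    -- the state invariant: predecessor property, preserved by legal moves off the cut, top exclusion
    {P : EuclideanSpace ℝ (Fin 3) × List (EuclideanSpace ℝ (Fin 3)) → Prop}
    (hPpred : ∀ (b : EuclideanSpace ℝ (Fin 3)) (κ : List (EuclideanSpace ℝ (Fin 3))), WF κ → P (b, κ) → b - F κ (u κ) ∈ X)
    (hPstraight : ∀ (b : EuclideanSpace ℝ (Fin 3)) (κ : List (EuclideanSpace ℝ (Fin 3))), WF κ →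
      (IsFull X (F κ) b ∨ (∃ m, IsTwinReading X (F κ) m b ∧ ⟪F κ (u κ), m⟫_ℝ = 0) ∨
        (ver = WordVersion.v2 ∧ IsNarrow X (F κ) (F κ (u κ)) b)) →
      P (b, κ) → P (b + F κ (u κ), κ))
    (hPcross : ∀ (b : EuclideanSpace ℝ (Fin 3)) (κ : List (EuclideanSpace ℝ (Fin 3))) (m : EuclideanSpace ℝ (Fin 3)),
      WF κ → WF (next κ m) → IsTwinReading X (F κ) m b → ⟪F κ (u κ), m⟫_ℝ = Real.sqrt (2 / 3) →
      (κ ≠ [] ∨ m ≠ n) →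
      P (b, κ) → P (b + F (next κ m) (u (next κ m)), next κ m))
    (hPexcl0 : ∀ (b : EuclideanSpace ℝ (Fin 3)) (κ : List (EuclideanSpace ℝ (Fin 3))), WF κ → P (b, κ) → b ∈ P₂ →
      (∃ a ∈ fccSlots, ∃ a' ∈ fccSlots, ∃ a'' ∈ fccSlots,
        ⟪a, a'⟫_ℝ = 1 / 2 ∧ ⟪a, a''⟫_ℝ = 1 / 2 ∧ ⟪a', a''⟫_ℝ = 1 / 2 ∧
        b + F κ a ∈ X ∧ b + F κ a' ∈ X ∧ b + F κ a'' ∈ X) → False)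
    (hup : 0 < (F [] (u [])) 2) (hR₀ : 3 ≤ R₀) (hρ : R₀ ≤ ρ)
    -- the located READINGS: twin readings of `(A, n)` whose mirror balls move straight; the invariant one step later
    (Rd : Finset (EuclideanSpace ℝ (Fin 3))) (hRd : ∀ r ∈ Rd, r ∈ X ∧ IsTwinReading X A n r)
    (hmov : ∀ r ∈ Rd, IsFull X (F []) (r + F [] (u [])) ∨
      (∃ m, IsTwinReading X (F []) m (r + F [] (u [])) ∧ ⟪F [] (u []), m⟫_ℝ = 0) ∨
      (ver = WordVersion.v2 ∧ IsNarrow X (F []) (F [] (u [])) (r + F [] (u []))))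
    (hP0 : ∀ r ∈ Rd, P (r + F [] (u []) + F [] (u []), []))
    -- the bottom plate's CORE and the top plate's sealing, verbatim
    (hP'top : ∀ p ∈ P', p 2 ≤ -R₀ - 1)
    (hstd : ∀ κ, WF κ → ∀ p ∈ P', (∃ a ∈ fccSlots, ∃ a' ∈ fccSlots, ∃ a'' ∈ fccSlots,
        ⟪a, a'⟫_ℝ = 1 / 2 ∧ ⟪a, a''⟫_ℝ = 1 / 2 ∧ ⟪a', a''⟫_ℝ = 1 / 2 ∧
        p + F κ a ∈ X ∧ p + F κ a' ∈ X ∧ p + F κ a'' ∈ X) → F κ (u κ) = F [] (u []))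
    (hsealB : ∀ s ∈ X, s ∉ P' → -R₀ - 1 - 1 ≤ s 2 → s 2 < -R₀ - 1 → s 0 ^ 2 + s 1 ^ 2 ≤ (ρ - 1) ^ 2 → False)
    (hP₂seal : ∀ s ∈ X, h + R₀ + 1 ≤ s 2 → s 2 ≤ h + R₀ + 1 + 1 → s 0 ^ 2 + s 1 ^ 2 ≤ (ρ - 2) ^ 2 → s ∈ P₂) :
    ∃ T : Finset (EuclideanSpace ℝ (Fin 3) × EuclideanSpace ℝ (Fin 3)),
      (Rd.filter fun r => -R₀ - 1 < (r + F [] (u []) + F [] (u [])) 2 ∧ (r + F [] (u []) + F [] (u [])) 2 < h + R₀ + 1).card ≤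
        T.card +
        (X.filter fun b => -R₀ - 1 ≤ b 2 ∧ b 2 < h + R₀ + 1 ∧ IsTwinReading X (F []) n b ∧ P (b, []) ∧ b - F [] (u []) ∈ X).card +
        220 * (X.filter fun s => h + R₀ + 1 ≤ s 2 ∧ s 2 ≤ h + R₀ + 1 + 1 ∧ (ρ - 2) ^ 2 < s 0 ^ 2 + s 1 ^ 2).card +
        220 * (X.filter fun s => -R₀ - 1 - 1 ≤ s 2 ∧ s 2 < -R₀ - 1 ∧ (ρ - 1) ^ 2 < s 0 ^ 2 + s 1 ^ 2).card ∧
      (∀ bq ∈ T, bq.1 ∈ X ∧ bq.2 ∈ X ∧ dist bq.1 bq.2 = 1 ∧ -R₀ - 1 ≤ bq.1 2 ∧ bq.1 2 < h + R₀ + 1) ∧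
      (∀ bq ∈ T, (X.filter fun q => dist bq.1 q = 1).card ≤ 11 ∨
        ∃ z₁ ∈ X, ∃ z₂ ∈ X, z₁ ≠ z₂ ∧ dist bq.1 z₁ = 1 ∧ dist bq.1 z₂ = 1 ∧
          (X.filter fun q => dist z₁ q = 1).card ≤ 11 ∧ (X.filter fun q => dist z₂ q = 1).card ≤ 11) ∧
      (∀ bq ∈ T, ∃ κ, WF κ ∧ P (bq.1, κ)) ∧
      (∀ bq ∈ T, ∃ κ, WF κ ∧ bq.2 - F κ (u κ) ∈ X ∧ IsEndMove X ver (F κ) (F κ (u κ)) bq.2 bq.1) := by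
  have hr : 0 < Real.sqrt (2 / 3) := Real.sqrt_pos.2 (by norm_num)
  set μ₀ : EuclideanSpace ℝ (Fin 3) := (F []).symm n with hμ₀def
  have hFμ₀ : F [] μ₀ = n := by rw [hμ₀def, LinearIsometryEquiv.apply_symm_apply]
  -- the root direction crosses `n` upward; hence `⟪u [], μ₀⟫ = √(2/3)`
  have hdn : ∀ r ∈ Rd, ⟪F [] (u []), n⟫_ℝ = Real.sqrt (2 / 3) := by
    intro r hr'
    obtain ⟨hmenu, -⟩ := (hRd r hr').2
    have nn : ⟪n, n⟫_ℝ = 1 := by rw [real_inner_self_eq_norm_sq, hmenu.1, one_pow]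
    rw [hA', inner_sub_left, real_inner_smul_left, nn, inner_eq_neg_of_near A hmenu (hu []) hwn]; ring
  set L : Finset (EuclideanSpace ℝ (Fin 3)) := Rd.image fun r => r + F [] (u []) with hL
  have hLmem : ∀ p ∈ L, ∃ r ∈ Rd, p = r + F [] (u []) := fun p hp => by
    obtain ⟨r, hr', rfl⟩ := mem_image.1 hp; exact ⟨r, hr', rfl⟩
  -- empty `Rd`: nothing to count
  by_cases hRd0 : Rd = ∅
  · refine ⟨∅, ?_, by simp, by simp, by simp, by simp⟩
    rw [hRd0]; simp
  obtain ⟨r₀, hr₀⟩ := Finset.nonempty_iff_ne_empty.2 hRd0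
  have hdn₀ : ⟪F [] (u []), n⟫_ℝ = Real.sqrt (2 / 3) := hdn r₀ hr₀
  have hμ₀ : ⟪u [], μ₀⟫_ℝ = Real.sqrt (2 / 3) := by
    rw [← LinearIsometryEquiv.inner_map_map (F []), hFμ₀]; exact hdn₀
  -- the cut census
  have hPcross' : ∀ (b : EuclideanSpace ℝ (Fin 3)) (κ : List (EuclideanSpace ℝ (Fin 3))) (m : EuclideanSpace ℝ (Fin 3)),
      WF κ → WF (next κ m) → IsTwinReading X (F κ) m b → ⟪F κ (u κ), m⟫_ℝ = Real.sqrt (2 / 3) →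
      (κ ≠ [] ∨ m ≠ F [] μ₀) → P (b, κ) → P (b + F (next κ m) (u (next κ m)), next κ m) := by
    intro b κ m hκ hκ' htd hdm hoff; rw [hFμ₀] at hoff; exact hPcross b κ m hκ hκ' htd hdm hoff
  have hLsrc : ∀ p ∈ L, p ∈ X ∧
      (∃ a ∈ fccSlots, ∃ a' ∈ fccSlots, ∃ a'' ∈ fccSlots,
        ⟪a, a'⟫_ℝ = 1 / 2 ∧ ⟪a, a''⟫_ℝ = 1 / 2 ∧ ⟪a', a''⟫_ℝ = 1 / 2 ∧
        p + F [] a ∈ X ∧ p + F [] a' ∈ X ∧ p + F [] a'' ∈ X) ∧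
      p - F [] (u []) ∈ X ∧
      (IsFull X (F []) p ∨ (∃ m, IsTwinReading X (F []) m p ∧ ⟪F [] (u []), m⟫_ℝ = 0) ∨
        (ver = WordVersion.v2 ∧ IsNarrow X (F []) (F [] (u [])) p)) ∧
      P (p + F [] (u []), []) := by
    intro p hp
    obtain ⟨r, hr', rfl⟩ := hLmem p hp
    obtain ⟨hrX, hread⟩ := hRd r hr'
    exact ⟨mirrorLaunch_mem A (F []) hread (hu []) hwn hA', mirrorLaunch_face A (F []) hrX hread (hu []) hwn hA',
      by rw [add_sub_cancel_right]; exact hrX, hmov r hr', hP0 r hr'⟩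
  have hLstep : ∀ p ∈ L, p + F [] (u []) ∉ L := mirrorLaunch_step_not_mem A (F []) hX hRd (hu []) hwn hA'
  obtain ⟨T, hbound, h1, h2, h3, h4⟩ := word_family_endPairs_launch_cut ver hg hc hX hFc hu huc hWF0 hWFc hnext_pop hnext_push hμ₀
    hPstraight hPcross' hPexcl0 hup hR₀ hρ L hLsrc hLstep hP'top hstd hsealB hP₂seal
  refine ⟨T, ?_, h1, h2, h3, h4⟩
  -- re-index the launches by their readings
  have hcardL : (Rd.filter fun r => -R₀ - 1 < (r + F [] (u []) + F [] (u [])) 2 ∧ (r + F [] (u []) + F [] (u [])) 2 < h + R₀ + 1).card =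
      (L.filter fun p => -R₀ - 1 < (p + F [] (u [])) 2 ∧ (p + F [] (u [])) 2 < h + R₀ + 1).card := by
    rw [hL, Finset.filter_image, card_image_of_injective _ (add_left_injective _)]
  rw [hcardL]
  refine hbound.trans ?_
  -- the relaunch term is EMPTY for mirror launches
  rw [Finset.card_eq_zero.2 ((Finset.filter_eq_empty_iff (s := L)).2 ?_), add_zero]
  · -- the cut term, with `F [] μ₀ = n`
    refine Nat.add_le_add_right (Nat.add_le_add_right (Nat.add_le_add_left (card_le_card fun b hb => ?_) _) _) _
    rw [mem_filter] at hb ⊢; rw [hFμ₀] at hb; exact hb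
  · intro p hp hpred
    obtain ⟨r, hr', rfl⟩ := hLmem p hp
    obtain ⟨hrX, hread⟩ := hRd r hr'
    simp only [add_sub_cancel_right] at hpred
    rcases hpred with ⟨hP, -, -, -⟩ | ⟨μ, hwf, hne, -, -, -, m, htd, -, hnil⟩
    · -- straight: the second predecessor `r − A′w` would be present
      exact pred_mirrorLaunch_not_mem A (F []) hX hread (hu []) hwn hA' (hPpred r [] hWF0 hP)
    · -- cross: the popping letter reads `(M_μ ≫ A′, A′μ)` at the reading `r`, so `μ = μ₀`
      obtain ⟨-, hμ1, -, hwμ, -⟩ := (hWFc μ []).1 hwf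
      have hm : m = F [] μ := normal_eq_of_next_singleton_nil hFc hnext_push hμ1 hnil
      rw [hm, hFc] at htd
      exact hne (relaunch_letter_eq hX A (F []) hread hdn₀ hwμ htd)

end Summit.Ventures.Crystal3D.Cruxes.TextureLiminf.TexShadow

end
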